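import Literature.MathematicalPhysics.QuantumFieldTheory.Balaban1983to89.B7Prop2Explicit
import Literature.MathematicalPhysics.QuantumFieldTheory.Balaban1983to89.BlockAveragingFederbush
import Literature.Analysis.Complex.RungeUnits
import Mathlib.Topology.MetricSpace.Contracting
import Mathlib.Topology.Algebra.Star.Unitary
import HarnessLib

/-!
# T⁴ programme, node NE3 — the kinematic refinement lemma, leaf R2a: THE CHAIN-END CONTRACTION
# (exactness of Bałaban's block average (42) is one matrix fixed point per coarse bond)

Seventeenth generation of the NE3 prover lineage P1 of the cell `pub-balaban` (unit `b2b-balaban-t4-ne3-p1`, OWNER of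
`BINDER-OWNERS.md` row NE3; assigned technique: implicit function ∕ contraction mapping).  Companion of
`Support/MinimalActionRefine` (the re-cut of the sandwich's refinement hypothesis (H2) to the KINEMATIC shape
`SmoothRefine`; skeleton `t4/b2b-balaban-t4-ne3-p1/SKELETON-NE3-P1.md` v1.1 §3 leaves R1–R2).

## The mechanism (skeleton v1.1 §2 ¶3, leaf R2)

Let `W` be a fine configuration, `U` a coarse target, and modify `W` on the CHAIN-END bond
`⟨Lz + (L−1)e_κ, Lz + Le_κ⟩` of the coarse bond `(z, κ)` by right multiplication with `c`.  The loop variables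
`Wcx L W (L·z) κ r = W(Γ_{c,x})W(c)⁻¹` of (42) (B7 = [Balaban1985Averaging] (42) p. 23) based at the block corner never
traverse a chain end through their tree words, the off-line lines (`r_⊥ ≠ 0`) contain none, and the on-line loops are
degenerate (`= 1`).  Hence (leaf R2b, module `ChainEndWords`) with `S = W(c)` the chain product and `w_r` the unmodified
off-line loop variables,
  `X_c(W_c) = L^{−d} Σ_{r off-line} log (w_r · S c⁻¹ S⁻¹)`,   `\bar{W_c}(c) = exp(X_c(W_c)) · S · c`,
and the exactness equation `\bar{W_c}(c) = U(c)` is the fixed-point equation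
  `c = Φ(c) := S⁻¹ · exp(−X(c)) · U(c)`,   `X(c) := λ Σ_i log (w_i · S c⋆ S⋆)`,  `λ = L^{−d}`, `#i = L^d − L`,
for ONE unknown unitary `c` per coarse bond — no coupling between bonds.

## This file (abstract, in any non-trivial C⋆-algebra `𝔸`; [folklore] functional analysis)

§1 the twisted loop variables `twist w s c i = w_i · s c⋆ s⋆` and `chainX lam w s c = lam • Σ_i mlog (twist w s c i)`:
closeness to `1`, unitarity, Lipschitz in `c` (the tree's `FederbushMean.norm_mlog_sub_mlog_le`: `log` is
`(1 + β/(1−β))`-Lipschitz on `‖· − 1‖ ≤ β`), skew-adjointness (the tree's `star_mlog_eq_neg`, (22)–(23) of B7);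
§2 the map `chainMap lam w s u c = s⋆ · exp(−chainX …) · u`: unitarity (Mathlib `exp_mem_unitary_of_mem_skewAdjoint`),
Lipschitz constant `κ₀ · e^{κ₀β′} · (1 + β′)` with `κ₀ = lam · #ι`, `β′ = β/(1−β)` (the tree's
`Literature.Analysis.Complex.norm_exp_sub_exp_le`), and the real inequality `κ₀ e^{κ₀β′}(1+β′) ≤ (1+κ₀)/2` once
`4β ≤ 1 − κ₀` (§2, `contraction_const_le`);
§3 **`exists_chainEnd_fixedPoint`**: if `0 ≤ κ₀ < 1` (gap `g = 1 − κ₀`; in the application `g = L^{1−d}`), the data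
`w_i` are unitary with `‖w_i − 1‖ ≤ α`, `s, u` unitary with MISMATCH `‖u − exp(chainX lam w s 1)·s‖ ≤ δ`, and
`4(α + 2δ/g) ≤ g`, then there is a UNITARY `c` with `‖c − 1‖ ≤ 2δ/g` and
  `exp(chainX lam w s c) · s · c = u`
(Banach's fixed-point theorem, Mathlib `ContractingWith.exists_fixedPoint'`, on the complete set
`{c unitary, ‖c − 1‖ ≤ 2δ/g}`, contraction constant `(1+κ₀)/2`).

HONEST FRAMING.  Elementary functional analysis in a C⋆-algebra; nothing here is specific to Yang–Mills beyond the
shape of (42); no conditional of the cell (`BetaPertH`, (B), (B^μ)) is used or hidden; nothing bears on infinite volume,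
a mass gap, or the Clay problem; **NE3 is NOT proved** (this is leaf R2a of the kinematic lemma `SmoothRefine`, whose
leaves R1, R2b remain open).  ABSOLUTE RULE of the cell kept: no printed sentence is a hypothesis of any declaration;
no `sorry`, no axioms beyond Mathlib's.  PLACEMENT (human rule 2026-08-19): cell work under
`Summits/QuantumFields/BalabanUV/`; imports tree Literature modules only (B7Prop2Explicit, BlockAveragingFederbush,
RungeUnits) and Mathlib; moves nothing.  Records: skeleton v1.1, `t4/T4-EST-NE3-P1.md` of the cell `pub-balaban`.
-/

set_option autoImplicit false

open scoped BigOperators NNReal ENNReal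
open NormedSpace

namespace Summit.QuantumFields.BalabanUV.T4Continuum.ChainEndContraction

open Literature.MathematicalPhysics.QuantumFieldTheory.Balaban1983to89
open MatrixLog FederbushMean B7Prop1Explicit B7Prop2Explicit

noncomputable section

variable {𝔸 : Type*} [CStarAlgebra 𝔸]
variable {ι : Type*} [Fintype ι]

/-! ## §1 The twisted loop variables and the exponent `X(c)` -/

/-- The twisted loop variable `Y_i(c) = w_i · s c⋆ s⋆` (the off-line loop variable of (42) after the chain-end
modification `c`, written with `c⁻¹ = c⋆`, `S⁻¹ = S⋆` for unitaries). [folklore] -/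
def twist (w : ι → 𝔸) (s c : 𝔸) (i : ι) : 𝔸 := w i * (s * star c * star s)

/-- The exponent `X(c) = lam • Σ_i log Y_i(c)` (`lam = L^{−d}` in the application). [folklore] -/
def chainX (lam : ℝ) (w : ι → 𝔸) (s c : 𝔸) : 𝔸 := lam • ∑ i, mlog (twist w s c i)

omit [Fintype ι] in
/-- At `c = 1` the twist is trivial: `Y_i(1) = w_i` (`s s⋆ = 1`). [folklore] -/
theorem twist_one {w : ι → 𝔸} {s : 𝔸} (hs : s ∈ unitary 𝔸) (i : ι) : twist w s 1 i = w i := by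
  simp [twist, Unitary.mul_star_self_of_mem hs]

omit [Fintype ι] in
/-- The twist is unitary when `w_i, s, c` are. [folklore] -/
theorem twist_mem_unitary {w : ι → 𝔸} {s c : 𝔸} (hw : ∀ i, w i ∈ unitary 𝔸) (hs : s ∈ unitary 𝔸)
    (hc : c ∈ unitary 𝔸) (i : ι) : twist w s c i ∈ unitary 𝔸 :=
  Submonoid.mul_mem _ (hw i)
    (Submonoid.mul_mem _ (Submonoid.mul_mem _ hs (Unitary.star_mem hc)) (Unitary.star_mem hs))

variable [Nontrivial 𝔸]

omit [Fintype ι] in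
/-- The twist differs from `1` by at most `‖w_i − 1‖ + ‖c − 1‖`:
`Y_i(c) − 1 = w_i s (c⋆ − 1) s⋆ + (w_i − 1)`. [folklore] -/
theorem norm_twist_sub_one_le {w : ι → 𝔸} {s c : 𝔸} (hw : ∀ i, w i ∈ unitary 𝔸) (hs : s ∈ unitary 𝔸) (i : ι) :
    ‖twist w s c i - 1‖ ≤ ‖w i - 1‖ + ‖c - 1‖ := by
  have hss : s * star s = 1 := Unitary.mul_star_self_of_mem hs
  have hid : twist w s c i - 1 = w i * (s * (star c - 1) * star s) + (w i - 1) := by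
    simp only [twist, mul_sub, sub_mul, mul_one, hss]; abel
  rw [hid]
  refine (norm_add_le _ _).trans ?_
  rw [add_comm]
  refine add_le_add le_rfl ?_
  calc ‖w i * (s * (star c - 1) * star s)‖ ≤ ‖w i‖ * (‖s‖ * ‖star c - 1‖ * ‖star s‖) := by
        refine (norm_mul_le _ _).trans (mul_le_mul_of_nonneg_left ?_ (norm_nonneg _))
        exact (norm_mul_le _ _).trans (mul_le_mul_of_nonneg_right (norm_mul_le _ _) (norm_nonneg _))
    _ ≤ 1 * (1 * ‖star c - 1‖ * 1) := by
        have h1 := (CStarRing.norm_of_mem_unitary (hw i)).le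
        have h2 := (CStarRing.norm_of_mem_unitary hs).le
        have h3 : ‖star s‖ ≤ 1 := by rw [norm_star]; exact h2
        gcongr
    _ = ‖c - 1‖ := by rw [one_mul, one_mul, mul_one, ← norm_star (c - 1), star_sub, star_one]

omit [Fintype ι] in
/-- The twist is `1`-Lipschitz in `c`: `Y_i(c₁) − Y_i(c₂) = w_i s (c₁⋆ − c₂⋆) s⋆`. [folklore] -/
theorem norm_twist_sub_twist_le {w : ι → 𝔸} {s : 𝔸} (hw : ∀ i, w i ∈ unitary 𝔸) (hs : s ∈ unitary 𝔸)
    (c₁ c₂ : 𝔸) (i : ι) : ‖twist w s c₁ i - twist w s c₂ i‖ ≤ ‖c₁ - c₂‖ := by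
  have hid : twist w s c₁ i - twist w s c₂ i = w i * (s * (star c₁ - star c₂) * star s) := by
    simp only [twist, mul_sub, sub_mul]
  rw [hid]
  calc ‖w i * (s * (star c₁ - star c₂) * star s)‖ ≤ ‖w i‖ * (‖s‖ * ‖star c₁ - star c₂‖ * ‖star s‖) := by
        refine (norm_mul_le _ _).trans (mul_le_mul_of_nonneg_left ?_ (norm_nonneg _))
        exact (norm_mul_le _ _).trans (mul_le_mul_of_nonneg_right (norm_mul_le _ _) (norm_nonneg _))
    _ ≤ 1 * (1 * ‖star c₁ - star c₂‖ * 1) := by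
        have h1 := (CStarRing.norm_of_mem_unitary (hw i)).le
        have h2 := (CStarRing.norm_of_mem_unitary hs).le
        have h3 : ‖star s‖ ≤ 1 := by rw [norm_star]; exact h2
        gcongr
    _ = ‖c₁ - c₂‖ := by rw [one_mul, one_mul, mul_one, ← star_sub, norm_star]

/-- `t ↦ t/(1−t)` is monotone below `1` (re-export of the tree's lemma for local use). [folklore] -/
theorem div_one_sub_mono {t β : ℝ} (ht : t ≤ β) (hβ : β < 1) : t / (1 - t) ≤ β / (1 - β) :=
  div_one_sub_le_div_one_sub ht hβ

omit [Nontrivial 𝔸] in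
/-- **Size of the exponent**: if every `‖Y_i(c) − 1‖ ≤ β < 1` and `0 ≤ lam`, then
`‖X(c)‖ ≤ lam · #ι · β/(1−β)` (B7 (26): `|log Y| ≤ |Y − 1|/(1 − |Y − 1|)`). [folklore] -/
theorem norm_chainX_le {lam β : ℝ} (hlam : 0 ≤ lam) (hβ : β < 1) {w : ι → 𝔸} {s c : 𝔸}
    (hY : ∀ i, ‖twist w s c i - 1‖ ≤ β) :
    ‖chainX lam w s c‖ ≤ lam * Fintype.card ι * (β / (1 - β)) := by
  unfold chainX
  rw [norm_smul, Real.norm_of_nonneg hlam, mul_assoc]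
  refine mul_le_mul_of_nonneg_left ?_ hlam
  calc ‖∑ i, mlog (twist w s c i)‖ ≤ ∑ i, ‖mlog (twist w s c i)‖ := norm_sum_le _ _
    _ ≤ ∑ _i : ι, β / (1 - β) := Finset.sum_le_sum fun i _ => by
        have hlt : ‖twist w s c i - 1‖ < 1 := (hY i).trans_lt hβ
        exact (norm_mlog_le_div hlt).trans (div_one_sub_mono (hY i) hβ)
    _ = Fintype.card ι * (β / (1 - β)) := by rw [Finset.sum_const, Finset.card_univ, nsmul_eq_mul]

/-- **Lipschitz bound for the exponent**: if every `‖Y_i(c₁) − 1‖, ‖Y_i(c₂) − 1‖ ≤ β < 1` and `0 ≤ lam`, then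
`‖X(c₁) − X(c₂)‖ ≤ lam · #ι · (1 + β/(1−β)) · ‖c₁ − c₂‖` (`log` is `(1 + β/(1−β))`-Lipschitz on the ball, the twist is
`1`-Lipschitz). [folklore] -/
theorem norm_chainX_sub_le {lam β : ℝ} (hlam : 0 ≤ lam) (hβ0 : 0 ≤ β) (hβ : β < 1) {w : ι → 𝔸} {s : 𝔸}
    (hw : ∀ i, w i ∈ unitary 𝔸) (hs : s ∈ unitary 𝔸) {c₁ c₂ : 𝔸}
    (h₁ : ∀ i, ‖twist w s c₁ i - 1‖ ≤ β) (h₂ : ∀ i, ‖twist w s c₂ i - 1‖ ≤ β) :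
    ‖chainX lam w s c₁ - chainX lam w s c₂‖ ≤ lam * Fintype.card ι * (1 + β / (1 - β)) * ‖c₁ - c₂‖ := by
  unfold chainX
  rw [← smul_sub, ← Finset.sum_sub_distrib, norm_smul, Real.norm_of_nonneg hlam, mul_assoc, mul_assoc]
  refine mul_le_mul_of_nonneg_left ?_ hlam
  have hL : 0 ≤ 1 + β / (1 - β) := by
    have : 0 ≤ β / (1 - β) := div_nonneg hβ0 (by linarith)
    linarith
  calc ‖∑ i, (mlog (twist w s c₁ i) - mlog (twist w s c₂ i))‖
      ≤ ∑ i, ‖mlog (twist w s c₁ i) - mlog (twist w s c₂ i)‖ := norm_sum_le _ _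
    _ ≤ ∑ _i : ι, (1 + β / (1 - β)) * ‖c₁ - c₂‖ := Finset.sum_le_sum fun i _ =>
        (norm_mlog_sub_mlog_le hβ (h₁ i) (h₂ i)).trans
          (mul_le_mul_of_nonneg_left (norm_twist_sub_twist_le hw hs c₁ c₂ i) hL)
    _ = Fintype.card ι * ((1 + β / (1 - β)) * ‖c₁ - c₂‖) := by
        rw [Finset.sum_const, Finset.card_univ, nsmul_eq_mul]

omit [Nontrivial 𝔸] in
/-- **The exponent is skew-adjoint** when the data are unitary and every `‖Y_i(c) − 1‖ ≤ 1/4` (B7 (22)–(23): the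
logarithm of a unitary close to `1` is skew-adjoint — the tree's `star_mlog_eq_neg`; real combinations stay skew). [folklore] -/
theorem chainX_mem_skewAdjoint (lam : ℝ) {w : ι → 𝔸} {s c : 𝔸} (hw : ∀ i, w i ∈ unitary 𝔸) (hs : s ∈ unitary 𝔸)
    (hc : c ∈ unitary 𝔸) (hY : ∀ i, ‖twist w s c i - 1‖ ≤ 1 / 4) : chainX lam w s c ∈ skewAdjoint 𝔸 := by
  unfold chainX
  refine skewAdjoint.smul_mem _ (sum_mem fun i _ => ?_)
  rw [skewAdjoint.mem_iff]
  exact star_mlog_eq_neg (twist_mem_unitary hw hs hc i) (hY i)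

/-! ## §2 The chain-end map `Φ(c) = s⋆ · exp(−X(c)) · u` -/

/-- **THE CHAIN-END MAP** `Φ(c) = s⋆ · exp(−X(c)) · u`: its fixed points are exactly the chain-end corrections `c` with
`exp(X(c)) · s · c = u` (§3). [folklore] -/
def chainMap (lam : ℝ) (w : ι → 𝔸) (s u c : 𝔸) : 𝔸 := star s * exp (-chainX lam w s c) * u

omit [Nontrivial 𝔸] in
/-- `exp` of a skew-adjoint element is unitary (Mathlib), hence so is `exp(−X(c))`. [folklore] -/
theorem exp_neg_chainX_mem_unitary (lam : ℝ) {w : ι → 𝔸} {s c : 𝔸} (hw : ∀ i, w i ∈ unitary 𝔸)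
    (hs : s ∈ unitary 𝔸) (hc : c ∈ unitary 𝔸) (hY : ∀ i, ‖twist w s c i - 1‖ ≤ 1 / 4) :
    exp (-chainX lam w s c) ∈ unitary 𝔸 := by
  letI : NormedAlgebra ℚ 𝔸 := NormedAlgebra.restrictScalars ℚ ℂ 𝔸
  exact NormedSpace.exp_mem_unitary_of_mem_skewAdjoint
    ((skewAdjoint 𝔸).neg_mem (chainX_mem_skewAdjoint lam hw hs hc hY))

omit [Nontrivial 𝔸] in
/-- `Φ(c)` is unitary for unitary data and `‖Y_i(c) − 1‖ ≤ 1/4`. [folklore] -/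
theorem chainMap_mem_unitary (lam : ℝ) {w : ι → 𝔸} {s u c : 𝔸} (hw : ∀ i, w i ∈ unitary 𝔸)
    (hs : s ∈ unitary 𝔸) (hu : u ∈ unitary 𝔸) (hc : c ∈ unitary 𝔸) (hY : ∀ i, ‖twist w s c i - 1‖ ≤ 1 / 4) :
    chainMap lam w s u c ∈ unitary 𝔸 :=
  Submonoid.mul_mem _ (Submonoid.mul_mem _ (Unitary.star_mem hs) (exp_neg_chainX_mem_unitary lam hw hs hc hY)) hu

/-- **Lipschitz bound for `Φ`** on the ball: with `κ₀ = lam · #ι`, `β′ = β/(1−β)`, if every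
`‖Y_i(c₁) − 1‖, ‖Y_i(c₂) − 1‖ ≤ β` (`0 ≤ β < 1`), then
`‖Φ(c₁) − Φ(c₂)‖ ≤ κ₀ (1 + β′) e^{κ₀β′} ‖c₁ − c₂‖` (`exp` is `e^{max‖·‖}`-Lipschitz — the tree's
`Literature.Analysis.Complex.norm_exp_sub_exp_le`; `s⋆`, `u` are contractions). [folklore] -/
theorem norm_chainMap_sub_le {lam β : ℝ} (hlam : 0 ≤ lam) (hβ0 : 0 ≤ β) (hβ : β < 1) {w : ι → 𝔸} {s u : 𝔸}
    (hw : ∀ i, w i ∈ unitary 𝔸) (hs : s ∈ unitary 𝔸) (hu : u ∈ unitary 𝔸) {c₁ c₂ : 𝔸}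
    (h₁ : ∀ i, ‖twist w s c₁ i - 1‖ ≤ β) (h₂ : ∀ i, ‖twist w s c₂ i - 1‖ ≤ β) :
    ‖chainMap lam w s u c₁ - chainMap lam w s u c₂‖
      ≤ lam * Fintype.card ι * (1 + β / (1 - β)) * Real.exp (lam * Fintype.card ι * (β / (1 - β)))
        * ‖c₁ - c₂‖ := by
  set κ₀ : ℝ := lam * Fintype.card ι with hκ₀
  set τ : ℝ := κ₀ * (β / (1 - β)) with hτ
  have hX₁ : ‖-chainX lam w s c₁‖ ≤ τ := by rw [norm_neg]; exact norm_chainX_le hlam hβ h₁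
  have hX₂ : ‖-chainX lam w s c₂‖ ≤ τ := by rw [norm_neg]; exact norm_chainX_le hlam hβ h₂
  have hexp : ‖exp (-chainX lam w s c₁) - exp (-chainX lam w s c₂)‖
      ≤ ‖chainX lam w s c₁ - chainX lam w s c₂‖ * Real.exp τ := by
    refine (Literature.Analysis.Complex.norm_exp_sub_exp_le _ _).trans ?_
    rw [show -chainX lam w s c₁ - -chainX lam w s c₂ = -(chainX lam w s c₁ - chainX lam w s c₂) by abel,
      norm_neg]
    exact mul_le_mul_of_nonneg_left (Real.exp_le_exp.mpr (max_le hX₁ hX₂)) (norm_nonneg _)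
  have hXsub := norm_chainX_sub_le hlam hβ0 hβ hw hs h₁ h₂
  have hid : chainMap lam w s u c₁ - chainMap lam w s u c₂
      = star s * (exp (-chainX lam w s c₁) - exp (-chainX lam w s c₂)) * u := by
    simp only [chainMap, mul_sub, sub_mul]
  rw [hid]
  have hs1 : ‖star s‖ ≤ 1 := by rw [norm_star]; exact (CStarRing.norm_of_mem_unitary hs).le
  have hu1 := (CStarRing.norm_of_mem_unitary hu).le
  calc ‖star s * (exp (-chainX lam w s c₁) - exp (-chainX lam w s c₂)) * u‖
      ≤ ‖star s‖ * ‖exp (-chainX lam w s c₁) - exp (-chainX lam w s c₂)‖ * ‖u‖ :=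
        (norm_mul_le _ _).trans (mul_le_mul_of_nonneg_right (norm_mul_le _ _) (norm_nonneg _))
    _ ≤ 1 * (‖chainX lam w s c₁ - chainX lam w s c₂‖ * Real.exp τ) * 1 := by gcongr
    _ ≤ 1 * (κ₀ * (1 + β / (1 - β)) * ‖c₁ - c₂‖ * Real.exp τ) * 1 := by gcongr
    _ = κ₀ * (1 + β / (1 - β)) * Real.exp τ * ‖c₁ - c₂‖ := by ring

omit [Fintype ι] [Nontrivial 𝔸] in
/-- **The contraction constant**: for `0 ≤ κ₀ ≤ 1`, `0 ≤ β` and `4β ≤ 1 − κ₀`,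
`κ₀ (1 + β′) e^{κ₀β′} ≤ (1 + κ₀)/2` with `β′ = β/(1−β)` (`e^{t} ≤ 1/(1−t)`, so the left side is at most
`κ₀(1+β′)/(1−β′) = κ₀/(1−2β)`). [folklore] -/
theorem contraction_const_le {κ₀ β : ℝ} (hκ0 : 0 ≤ κ₀) (hκ1 : κ₀ ≤ 1) (hβ0 : 0 ≤ β) (h4 : 4 * β ≤ 1 - κ₀) :
    κ₀ * (1 + β / (1 - β)) * Real.exp (κ₀ * (β / (1 - β))) ≤ (1 + κ₀) / 2 := by
  have hβ4 : β ≤ 1 / 4 := by linarith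
  have h1β : 0 < 1 - β := by linarith
  set β' : ℝ := β / (1 - β) with hβ'
  have hβ'0 : 0 ≤ β' := div_nonneg hβ0 h1β.le
  have hβ'le : β' ≤ 1 / 3 := by
    rw [hβ', div_le_iff₀ h1β]; linarith
  -- `e^{κ₀ β′} ≤ e^{β′} ≤ 1/(1 − β′)`
  have hexp : Real.exp (κ₀ * β') ≤ 1 / (1 - β') := by
    have h1 : Real.exp (κ₀ * β') ≤ Real.exp β' :=
      Real.exp_le_exp.mpr (by nlinarith)
    have h2 : Real.exp β' ≤ 1 / (1 - β') := by
      have h3 : 1 - β' ≤ Real.exp (-β') := by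
        have := Real.add_one_le_exp (-β'); linarith
      have h4 : 0 < 1 - β' := by linarith
      rw [le_div_iff₀ h4]
      calc Real.exp β' * (1 - β') ≤ Real.exp β' * Real.exp (-β') :=
            mul_le_mul_of_nonneg_left h3 (Real.exp_pos _).le
        _ = 1 := by rw [← Real.exp_add, add_neg_cancel, Real.exp_zero]
    exact h1.trans h2
  -- `(1 + β′)/(1 − β′) = 1/(1 − 2β)`
  have h12 : 0 < 1 - 2 * β := by linarith
  have hfrac : (1 + β') * (1 / (1 - β')) = 1 / (1 - 2 * β) := by
    rw [hβ']
    field_simp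
    ring
  calc κ₀ * (1 + β') * Real.exp (κ₀ * β')
      ≤ κ₀ * (1 + β') * (1 / (1 - β')) := by
        exact mul_le_mul_of_nonneg_left hexp (by positivity)
    _ = κ₀ * (1 / (1 - 2 * β)) := by rw [mul_assoc, hfrac]
    _ ≤ (1 + κ₀) / 2 := by
        rw [← mul_div_assoc, mul_one, div_le_iff₀ h12]
        nlinarith

/-! ## §3 The fixed point: existence of the exact chain-end correction -/

/-- **EXISTENCE OF THE EXACT CHAIN-END CORRECTION** (leaf R2a of the kinematic refinement lemma).  Let `𝔸` be a
non-trivial C⋆-algebra, `lam ≥ 0` with `κ₀ = lam · #ι < 1` (gap `g = 1 − κ₀`; in the application `lam = L^{−d}`,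
`#ι = L^d − L`, `g = L^{1−d}`), `w_i` unitary with `‖w_i − 1‖ ≤ α`, `s, u` unitary with MISMATCH
`‖u − exp(X(1)) · s‖ ≤ δ` (in the application: `‖U(c) − ar W(c)‖`), and `4(α + 2δ/g) ≤ g`.  Then there is a UNITARY
`c` with `‖c − 1‖ ≤ 2δ/g` and `exp(X(c)) · s · c = u`, where `X(c) = lam • Σ_i log (w_i s c⋆ s⋆)`.
Proof: Banach's fixed-point theorem for `Φ(c) = s⋆ exp(−X(c)) u` on the complete set `{c unitary, ‖c − 1‖ ≤ 2δ/g}`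
(invariant: `‖Φ(c) − 1‖ ≤ K·2δ/g + δ ≤ 2δ/g` with `K ≤ (1+κ₀)/2`), and `Φ(c) = c ⇒ exp(X(c)) s c = u`. [folklore] -/
theorem exists_chainEnd_fixedPoint {lam α δ : ℝ} (hlam : 0 ≤ lam) (hκ : lam * Fintype.card ι < 1)
    (hα : 0 ≤ α) (hδ : 0 ≤ δ) {w : ι → 𝔸} {s u : 𝔸} (hw : ∀ i, w i ∈ unitary 𝔸) (hwα : ∀ i, ‖w i - 1‖ ≤ α)
    (hs : s ∈ unitary 𝔸) (hu : u ∈ unitary 𝔸)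
    (hmis : ‖u - exp (chainX lam w s 1) * s‖ ≤ δ)
    (hsmall : 4 * (α + 2 * δ / (1 - lam * Fintype.card ι)) ≤ 1 - lam * Fintype.card ι) :
    ∃ c ∈ unitary 𝔸, ‖c - 1‖ ≤ 2 * δ / (1 - lam * Fintype.card ι) ∧ exp (chainX lam w s c) * s * c = u := by
  set κ₀ : ℝ := lam * Fintype.card ι with hκ₀
  have hκ0 : 0 ≤ κ₀ := by positivity
  set g : ℝ := 1 - κ₀ with hg
  have hg0 : 0 < g := by rw [hg]; linarith
  set ρ : ℝ := 2 * δ / g with hρ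
  have hρ0 : 0 ≤ ρ := div_nonneg (by positivity) hg0.le
  set β : ℝ := α + ρ with hβdef
  have hβ0 : 0 ≤ β := by positivity
  have h4β : 4 * β ≤ 1 - κ₀ := hsmall
  have hβ4 : β ≤ 1 / 4 := by linarith
  have hβ1 : β < 1 := by linarith
  -- the invariant set
  set S : Set 𝔸 := {c | c ∈ unitary 𝔸 ∧ ‖c - 1‖ ≤ ρ} with hSdef
  -- twists of points of `S` are within `β ≤ 1/4` of `1`
  have hYS : ∀ {c : 𝔸}, c ∈ S → ∀ i, ‖twist w s c i - 1‖ ≤ β := fun hc i =>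
    (norm_twist_sub_one_le hw hs i).trans (add_le_add (hwα i) hc.2)
  have hYS4 : ∀ {c : 𝔸}, c ∈ S → ∀ i, ‖twist w s c i - 1‖ ≤ 1 / 4 := fun hc i => (hYS hc i).trans hβ4
  have h1S : (1 : 𝔸) ∈ S := ⟨Submonoid.one_mem _, by simp [hρ0]⟩
  -- the Lipschitz constant
  set K : ℝ := κ₀ * (1 + β / (1 - β)) * Real.exp (κ₀ * (β / (1 - β))) with hKdef
  have hK0 : 0 ≤ K := by
    have : 0 ≤ β / (1 - β) := div_nonneg hβ0 (by linarith)
    positivity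
  have hKle : K ≤ (1 + κ₀) / 2 := contraction_const_le hκ0 hκ.le hβ0 h4β
  have hlip : ∀ {c₁ c₂ : 𝔸}, c₁ ∈ S → c₂ ∈ S →
      ‖chainMap lam w s u c₁ - chainMap lam w s u c₂‖ ≤ K * ‖c₁ - c₂‖ := fun h₁ h₂ =>
    norm_chainMap_sub_le hlam hβ0 hβ1 hw hs hu (hYS h₁) (hYS h₂)
  -- `Φ(1) − 1` is the mismatch
  have hΦ1 : ‖chainMap lam w s u 1 - 1‖ ≤ δ := by
    have hsu : star s * s = 1 := Unitary.star_mul_self_of_mem hs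
    have hE : exp (-chainX lam w s 1) * exp (chainX lam w s 1) = 1 := by
      have := (B7Prop1Explicit.expUnit (chainX lam w s 1)).inv_val
      simpa [B7Prop1Explicit.val_inv_expUnit] using this
    have hid : chainMap lam w s u 1 - 1
        = star s * exp (-chainX lam w s 1) * (u - exp (chainX lam w s 1) * s) := by
      rw [chainMap, mul_sub, show star s * exp (-chainX lam w s 1) * (exp (chainX lam w s 1) * s)
        = star s * (exp (-chainX lam w s 1) * exp (chainX lam w s 1)) * s by noncomm_ring, hE, mul_one, hsu]
    rw [hid]
    have hs1 : ‖star s‖ ≤ 1 := by rw [norm_star]; exact (CStarRing.norm_of_mem_unitary hs).le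
    have he1 : ‖exp (-chainX lam w s 1)‖ ≤ 1 :=
      (CStarRing.norm_of_mem_unitary
        (exp_neg_chainX_mem_unitary lam hw hs (Submonoid.one_mem _) (hYS4 h1S))).le
    calc ‖star s * exp (-chainX lam w s 1) * (u - exp (chainX lam w s 1) * s)‖
        ≤ ‖star s‖ * ‖exp (-chainX lam w s 1)‖ * ‖u - exp (chainX lam w s 1) * s‖ :=
          (norm_mul_le _ _).trans (mul_le_mul_of_nonneg_right (norm_mul_le _ _) (norm_nonneg _))
      _ ≤ 1 * 1 * δ := by gcongr
      _ = δ := by ring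
  -- invariance of `S`
  have hmaps : Set.MapsTo (chainMap lam w s u) S S := by
    intro c hc
    refine ⟨chainMap_mem_unitary lam hw hs hu hc.1 (hYS4 hc), ?_⟩
    have h1 : ‖chainMap lam w s u c - 1‖ ≤ K * ‖c - 1‖ + δ := by
      have := norm_sub_le_norm_sub_add_norm_sub (chainMap lam w s u c) (chainMap lam w s u 1) 1
      linarith [hlip hc h1S, this]
    have h2 : K * ‖c - 1‖ + δ ≤ (1 + κ₀) / 2 * ρ + δ := by
      have := mul_le_mul hKle hc.2 (norm_nonneg _) (by positivity); linarith
    have h3 : (1 + κ₀) / 2 * ρ + δ = ρ := by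
      have hne : (1 : ℝ) - κ₀ ≠ 0 := by linarith
      rw [hρ, hg]; field_simp; ring
    linarith
  -- completeness of `S`
  have hSc : IsComplete S := by
    apply IsClosed.isComplete
    have hS' : S = (unitary 𝔸 : Set 𝔸) ∩ Metric.closedBall (1 : 𝔸) ρ := by
      ext c; simp [hSdef, dist_eq_norm]
    rw [hS']
    exact isClosed_unitary.inter Metric.isClosed_closedBall
  -- the contraction on `S`
  set Kn : ℝ≥0 := ((1 + κ₀) / 2).toNNReal with hKn
  have hKnR : (Kn : ℝ) = (1 + κ₀) / 2 := Real.coe_toNNReal _ (by positivity)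
  have hKn1 : Kn < 1 := by
    rw [← NNReal.coe_lt_coe, hKnR, NNReal.coe_one]; linarith
  have hlipOn : LipschitzOnWith Kn (chainMap lam w s u) S := by
    refine LipschitzOnWith.of_dist_le_mul fun c₁ h₁ c₂ h₂ => ?_
    rw [dist_eq_norm, dist_eq_norm, hKnR]
    exact (hlip h₁ h₂).trans (mul_le_mul_of_nonneg_right hKle (norm_nonneg _))
  have hcontr : ContractingWith Kn (hmaps.restrict (chainMap lam w s u) S S) :=
    ⟨hKn1, hlipOn.mapsToRestrict hmaps⟩
  obtain ⟨c, hcS, hfix, -⟩ :=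
    ContractingWith.exists_fixedPoint' hSc hmaps hcontr h1S (edist_ne_top _ _)
  refine ⟨c, hcS.1, hcS.2, ?_⟩
  -- `Φ(c) = c` ⇒ `exp(X(c)) s c = u`
  have hfix' : star s * exp (-chainX lam w s c) * u = c := hfix
  have hss : s * star s = 1 := Unitary.mul_star_self_of_mem hs
  have hE : exp (chainX lam w s c) * exp (-chainX lam w s c) = 1 := by
    have := (B7Prop1Explicit.expUnit (chainX lam w s c)).val_inv
    simpa [B7Prop1Explicit.val_inv_expUnit] using this
  calc exp (chainX lam w s c) * s * c
      = exp (chainX lam w s c) * s * (star s * exp (-chainX lam w s c) * u) := by rw [hfix']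
    _ = exp (chainX lam w s c) * (s * star s) * exp (-chainX lam w s c) * u := by noncomm_ring
    _ = u := by rw [hss, mul_one, hE, one_mul]

end

end Summit.QuantumFields.BalabanUV.T4Continuum.ChainEndContraction

-- ops-buildfix-2 2026-08-23: no-op re-land to make the build lane rebuild and re-publish this module's artefacts (hub .olean page-truncated in the 18:18Z ENOSPC incident, LEDGER B18-1).
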